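import Mathlib
import Literature.Analysis.FluidPDE.HarmonicBallMeanValue
import HarnessLib

/-!
# Route SymmetryModuliCount — interior gradient estimate for harmonic functions of linear growth

Helper file serving the crux item stmt-NavierStokesRegularity-4054
(`Summit.NavierStokesRegularity.NavierStokesRegularity.Theses.SymmetryModuliCount.LinearLiouvilleSeven`),
line `galilean-collapse`, registered stub A1 `stub_harmonicLinearGrowthGradient`: the scale-invariant
global form of the interior derivative estimate for harmonic functions (Gilbarg–Trudinger,
Thm 2.10) on `ℝ³ = EuclideanSpace ℝ (Fin 3)`:

* there is an absolute constant `C₀ ≥ 0` such that every `f ∈ C²(ℝ³)` with `Δf = 0` and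
  `|f(x)| ≤ a + b‖x‖` (`a, b ≥ 0`) satisfies `‖Df(x)‖ ≤ C₀ b` for every `x`.

In the line this is applied to the pressure slice `q(t,·)` of a tempered ancient Stokes solution
(harmonic of linear growth, hence with bounded gradient) and to its partial derivatives (bounded
harmonic, hence slope `0`, hence constant gradient).

## Proof

Everything rests on the tree's interior gradient bound on a ball,
`Literature.Analysis.FluidPDE.abs_fderiv_apply_le_of_laplacian_eq_zero`
(`FluidPDE/HarmonicBallMeanValue`): for `h ∈ C²(ℝ³)` harmonic on `B(y, ρ)`, `ρ > r₁ > r₀ > 0`,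
`|Dh(y) e| ≤ ‖e‖ · M · ∫_{B̄(y, r₁)} |h|` with `M = sup ‖Dλ^{r₀,r₁}‖`
(`exists_bound_fderiv_newtonFarLaplacian`). We fix `r₀ = 1 < r₁ = 2 < ρ = 3` and apply it at
`y = 0` to the translate–rescale `h_R(z) = f(x + R z)`, `R > 0`, which is `C²`, harmonic on all of
`ℝ³` (`laplacian_comp_const_add`, `laplacian_const_smul_comp_smul`), has `Dh_R(0) e = R · Df(x) e`
(chain rule) and `|h_R| ≤ a + b‖x‖ + 2bR` on `B̄(0, 2)`. Hence
`R |Df(x) e| ≤ ‖e‖ M V (a + b‖x‖ + 2bR)` with `V = |B̄(0, 2)|`, and `R → ∞` gives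
`|Df(x) e| ≤ 2 M V b ‖e‖`, i.e. `‖Df(x)‖ ≤ C₀ b` with `C₀ = 2 M V`.

## References

* D. Gilbarg, N. S. Trudinger, *Elliptic partial differential equations of second order*
  (Springer, 2001 reprint), Thm 2.10 (interior derivative estimates for harmonic functions)
  [GilbargTrudinger2001].
-/

noncomputable section

open MeasureTheory Set Filter Metric Topology Function
open Literature.Analysis.FluidPDE
open scoped RealInnerProductSpace Laplacian ContDiff

namespace Summit.NavierStokesRegularity.NavierStokesRegularity.Theorems

/-- **Elementary limiting step.** If `R · D ≤ K + L · R` for every `R > 0`, with `K ≥ 0`, then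
`D ≤ L` (divide by `R` and let `R → ∞`; here: assume `D > L` and take `R = K/(D − L) + 1`).
[folklore] -/
theorem le_of_forall_pos_mul_le_add_mul {D K L : ℝ} (hK : 0 ≤ K)
    (h : ∀ R : ℝ, 0 < R → R * D ≤ K + L * R) : D ≤ L := by
  by_contra hcon
  have hδ : 0 < D - L := sub_pos.2 (not_le.1 hcon)
  have hR : 0 < K / (D - L) + 1 := by positivity
  have h1 := h _ hR
  have h2 : (K / (D - L) + 1) * (D - L) = K + (D - L) := by
    rw [add_mul, one_mul, div_mul_cancel₀ K hδ.ne']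
  have h3 : (K / (D - L) + 1) * D = L * (K / (D - L) + 1) + (K / (D - L) + 1) * (D - L) := by
    ring
  rw [h3, h2] at h1
  linarith

/-- **Harmonicity is invariant under translation and rescaling**: if `Δf = 0` on all of `ℝ³`,
then `z ↦ f(x + R z)` is harmonic on all of `ℝ³` for `R ≠ 0`
(`Δ(f(x + R ·))(w) = R² (Δf)(x + R w)`). [folklore] -/
theorem laplacian_comp_const_add_smul_eq_zero {f : EuclideanSpace ℝ (Fin 3) → ℝ}
    (hΔ : ∀ y, (Δ f) y = 0) (x : EuclideanSpace ℝ (Fin 3)) {R : ℝ} (hR : R ≠ 0)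
    (w : EuclideanSpace ℝ (Fin 3)) : (Δ (fun z => f (x + R • z))) w = 0 := by
  have h1 : (fun z => f (x + R • z)) = fun z => (1 : ℝ) • f (x + R • z) := by
    funext z; exact (one_smul ℝ _).symm
  rw [h1, laplacian_const_smul_comp_smul (fun y => f (x + y)) 1 hR w,
    laplacian_comp_const_add f x (R • w), hΔ, smul_zero]

/-- **Chain rule for the translate–rescale**: `D(f(x + R ·))(0) e = R · Df(x) e` for `f ∈ C²`.
[folklore] -/
theorem fderiv_comp_const_add_smul_zero_apply {f : EuclideanSpace ℝ (Fin 3) → ℝ}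
    (hf : ContDiff ℝ 2 f) (x : EuclideanSpace ℝ (Fin 3)) (R : ℝ) (e : EuclideanSpace ℝ (Fin 3)) :
    fderiv ℝ (fun z => f (x + R • z)) 0 e = R * fderiv ℝ f x e := by
  have h1 : HasFDerivAt (fun z : EuclideanSpace ℝ (Fin 3) => x + R • z)
      (R • ContinuousLinearMap.id ℝ (EuclideanSpace ℝ (Fin 3))) 0 :=
    ((hasFDerivAt_id (0 : EuclideanSpace ℝ (Fin 3))).const_smul R).const_add x
  have h2 : HasFDerivAt f (fderiv ℝ f x) (x + R • (0 : EuclideanSpace ℝ (Fin 3))) := by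
    rw [smul_zero, add_zero]
    exact ((hf.differentiable two_ne_zero) x).hasFDerivAt
  have h3 : HasFDerivAt (fun z => f (x + R • z))
      ((fderiv ℝ f x).comp (R • ContinuousLinearMap.id ℝ (EuclideanSpace ℝ (Fin 3)))) 0 :=
    h2.comp (0 : EuclideanSpace ℝ (Fin 3)) h1
  rw [h3.fderiv, ContinuousLinearMap.comp_apply]
  change fderiv ℝ f x (R • e) = R * fderiv ℝ f x e
  rw [map_smul, smul_eq_mul]

/-- **The scaled interior estimate.** For `f ∈ C²(ℝ³)` harmonic with `|f(y)| ≤ a + b‖y‖`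
(`b ≥ 0`), every `x, e` and every `R > 0`:
`R · |Df(x) e| ≤ ‖e‖ · M · ((a + b‖x‖ + 2bR) · |B̄(0,2)|)`, where `M` bounds `‖Dλ^{1,2}‖`
(the interior gradient bound `abs_fderiv_apply_le_of_laplacian_eq_zero` applied at `0` to
`z ↦ f(x + R z)` with radii `1 < 2 < 3`). [cite: GilbargTrudinger2001, Thm 2.10] -/
theorem mul_abs_fderiv_apply_le_of_laplacian_eq_zero_of_linear_growth {M : ℝ}
    (hM : ∀ z : EuclideanSpace ℝ (Fin 3), ‖fderiv ℝ (newtonFarLaplacian 1 2) z‖ ≤ M)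
    {f : EuclideanSpace ℝ (Fin 3) → ℝ} (hf : ContDiff ℝ 2 f) (hΔ : ∀ y, (Δ f) y = 0) {a b : ℝ}
    (hb : 0 ≤ b) (hgr : ∀ y, |f y| ≤ a + b * ‖y‖) (x e : EuclideanSpace ℝ (Fin 3)) {R : ℝ}
    (hR : 0 < R) :
    R * |fderiv ℝ f x e| ≤ ‖e‖ * M * ((a + b * ‖x‖ + 2 * b * R) *
      volume.real (closedBall (0 : EuclideanSpace ℝ (Fin 3)) 2)) := by
  have hM0 : 0 ≤ M := (norm_nonneg _).trans (hM 0)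
  -- the translate–rescale `h_R`
  set h : EuclideanSpace ℝ (Fin 3) → ℝ := fun z => f (x + R • z) with hh_def
  have hh : ContDiff ℝ 2 h := hf.comp (contDiff_const.add (contDiff_const_smul R))
  have hΔh : ∀ w ∈ ball (0 : EuclideanSpace ℝ (Fin 3)) (3 : ℝ), (Δ h) w = 0 := fun w _ =>
    laplacian_comp_const_add_smul_eq_zero hΔ x hR.ne' w
  have hball := abs_fderiv_apply_le_of_laplacian_eq_zero (r₀ := (1 : ℝ)) (r₁ := 2) one_pos
    one_lt_two hh (y := 0) (ρ := 3) (by norm_num) hΔh hM e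
  -- the left-hand side
  have hlhs : |fderiv ℝ h 0 e| = R * |fderiv ℝ f x e| := by
    rw [hh_def, fderiv_comp_const_add_smul_zero_apply hf x R e, abs_mul, abs_of_pos hR]
  -- the integral bound
  have hint : ∫ w in closedBall (0 : EuclideanSpace ℝ (Fin 3)) 2, |h w| ≤
      (a + b * ‖x‖ + 2 * b * R) * volume.real (closedBall (0 : EuclideanSpace ℝ (Fin 3)) 2) := by
    refine (Real.le_norm_self _).trans (norm_setIntegral_le_of_norm_le_const
      measure_closedBall_lt_top fun w hw => ?_)
    rw [Real.norm_eq_abs, abs_abs, hh_def]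
    rw [mem_closedBall_zero_iff] at hw
    calc |f (x + R • w)| ≤ a + b * ‖x + R • w‖ := hgr _
      _ ≤ a + b * (‖x‖ + R * 2) := by
          gcongr
          calc ‖x + R • w‖ ≤ ‖x‖ + ‖R • w‖ := norm_add_le _ _
            _ = ‖x‖ + R * ‖w‖ := by rw [norm_smul, Real.norm_eq_abs, abs_of_pos hR]
            _ ≤ ‖x‖ + R * 2 := by gcongr
      _ = a + b * ‖x‖ + 2 * b * R := by ring
  rw [← hlhs]
  exact hball.trans (mul_le_mul_of_nonneg_left hint (by positivity))

/-- **Pointwise directional form of the estimate.** For `f ∈ C²(ℝ³)` harmonic with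
`|f(y)| ≤ a + b‖y‖` (`a, b ≥ 0`): `|Df(x) e| ≤ 2 M |B̄(0,2)| b ‖e‖` for all `x, e`
(the scaled estimate divided by `R`, `R → ∞`). [cite: GilbargTrudinger2001, Thm 2.10] -/
theorem abs_fderiv_apply_le_of_laplacian_eq_zero_of_linear_growth {M : ℝ}
    (hM : ∀ z : EuclideanSpace ℝ (Fin 3), ‖fderiv ℝ (newtonFarLaplacian 1 2) z‖ ≤ M)
    {f : EuclideanSpace ℝ (Fin 3) → ℝ} (hf : ContDiff ℝ 2 f) (hΔ : ∀ y, (Δ f) y = 0) {a b : ℝ}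
    (ha : 0 ≤ a) (hb : 0 ≤ b) (hgr : ∀ y, |f y| ≤ a + b * ‖y‖) (x e : EuclideanSpace ℝ (Fin 3)) :
    |fderiv ℝ f x e| ≤
      2 * M * volume.real (closedBall (0 : EuclideanSpace ℝ (Fin 3)) 2) * b * ‖e‖ := by
  have hM0 : 0 ≤ M := (norm_nonneg _).trans (hM 0)
  refine le_of_forall_pos_mul_le_add_mul
    (K := ‖e‖ * M * volume.real (closedBall (0 : EuclideanSpace ℝ (Fin 3)) 2) * (a + b * ‖x‖))
    (by positivity) fun R hR => ?_
  have key := mul_abs_fderiv_apply_le_of_laplacian_eq_zero_of_linear_growth hM hf hΔ hb hgr x e hR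
  have halg : ‖e‖ * M * ((a + b * ‖x‖ + 2 * b * R) *
      volume.real (closedBall (0 : EuclideanSpace ℝ (Fin 3)) 2)) =
      ‖e‖ * M * volume.real (closedBall (0 : EuclideanSpace ℝ (Fin 3)) 2) * (a + b * ‖x‖) +
      2 * M * volume.real (closedBall (0 : EuclideanSpace ℝ (Fin 3)) 2) * b * ‖e‖ * R := by
    ring
  rw [halg] at key
  exact key

/-- **Interior gradient estimate for harmonic functions of linear growth on `ℝ³`, scale-invariant
form** (registered stub A1 of crux stmt-NavierStokesRegularity-4054
`SymmetryModuliCount.LinearLiouvilleSeven`, line `galilean-collapse`): there is an absolute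
constant `C₀ ≥ 0` such that every `f ∈ C²(ℝ³)` with `Δf = 0` everywhere and
`|f(x)| ≤ a + b‖x‖` for all `x` (`a, b ≥ 0`) has `‖Df(x)‖ ≤ C₀ b` for every `x`. This is the
classical interior derivative estimate `|Du(y)| ≤ (n/d) sup_{B_d(y)} |u|` (Gilbarg–Trudinger,
Thm 2.10) made global by applying it on balls of radius `∼ R` around `x` and letting `R → ∞`;
here `C₀ = 2 M |B̄(0,2)|` with `M = sup ‖Dλ^{1,2}‖` the gradient bound of the tree's mean-value
weight (`exists_bound_fderiv_newtonFarLaplacian`). In particular (`b = 0`) bounded harmonic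
functions on `ℝ³` are constant. [cite: GilbargTrudinger2001, Thm 2.10] -/
theorem stub_harmonicLinearGrowthGradient :
    ∃ C₀ : ℝ, 0 ≤ C₀ ∧ ∀ (f : EuclideanSpace ℝ (Fin 3) → ℝ) (a b : ℝ), ContDiff ℝ 2 f → (∀ x,
    Laplacian.laplacian f x = 0) → 0 ≤ a → 0 ≤ b → (∀ x, |f x| ≤ a + b * ‖x‖) → ∀ x, ‖fderiv ℝ f x‖
    ≤ C₀ * b := by
  obtain ⟨M, hM0, hM⟩ :=
    exists_bound_fderiv_newtonFarLaplacian (r₀ := (1 : ℝ)) (r₁ := 2) one_pos one_lt_two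
  refine ⟨2 * M * volume.real (closedBall (0 : EuclideanSpace ℝ (Fin 3)) 2), by positivity, ?_⟩
  intro f a b hf hΔ ha hb hgr x
  refine ContinuousLinearMap.opNorm_le_bound _ (by positivity) fun e => ?_
  rw [Real.norm_eq_abs]
  exact abs_fderiv_apply_le_of_laplacian_eq_zero_of_linear_growth hM hf hΔ ha hb hgr x e

end Summit.NavierStokesRegularity.NavierStokesRegularity.Theorems

end
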